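import Literature.AlgebraicGeometry.Resolution.ArithmeticalThreefoldsDescentHeadBase
import Literature.AlgebraicGeometry.Resolution.ArithmeticalThreefoldsLocalFrameDim
import Literature.AlgebraicGeometry.Resolution.ExcellentRingsCompleteHolds
import Literature.AlgebraicGeometry.Resolution.ExcellentRingsEssFiniteType
import Literature.AlgebraicGeometry.Resolution.ExcellentClosedSubschemes
import Literature.AlgebraicGeometry.Resolution.RegularSystemOfParameters
import Mathlib.RingTheory.AdicCompletion.LocalRing
import HarnessLib

/-!
# Cossart–Piltant 2019, Prop. 4.8: (LU) for `A` from a bare regular model with `K`-finite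
# denominators — the plumbing of `exists_adjoin_isRegularLocalRing_of_frameBase`

Topic: `Literature/AlgebraicGeometry/Resolution` (proofs only; no new notions, no new named
facts). `exists_adjoin_isRegularLocalRing_of_frameBase` (`ArithmeticalThreefoldsDescentHeadBase.lean`)
runs the computational part of the geometric head of Cossart–Piltant's descent (J. Algebra 529
(2019) = arXiv:1412.0868, proof of Prop. 4.8 with Lemma 4.7 and (510)–(512); arXiv v1
Prop. 4.6, pp. 52–53) from a regular local ring `S₀` GIVEN WITH all its structure (excellent,
of dimension `3`, essentially of finite type over `Â`, algebraic and residually algebraic data,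
a regular system of parameters, and an identification of its image with the local ring at the
centre of `v̂` of a model `Â[t₀]`). Here all of that structure is DERIVED from the bare model:

* `exists_adjoin_isRegularLocalRing_of_model` — (LU) for `A` at `v` from: the rank data of `v`,
  embedded resolution of surfaces (`hEmb`), the chosen formal branch `K̂₁ = Frac(Â/P̂₁)` with
  `dim Â/P̂₁ = 3` and extension `O'` of `v`, and a finite set `t₀ ⊆ K̂₁` of fractions with
  `K`-FINITE denominators such that `Â[t₀] ⊆ O'` and the local ring `(Â[t₀])_{𝔪_{v̂} ∩ Â[t₀]}`
  is regular (in the source: `𝒪_{Ŷ,ŷ}` for `Ŷ → Spec Â` an isomorphism above `Spec Â_g`).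

The derived structure: `S₀ := (Â[t₀])_{𝔪_{v̂} ∩ Â[t₀]} ⊆ K̂₁` is essentially of finite type over
the complete local ring `Â`, hence excellent (`isExcellentRing_of_isAdicComplete`,
`IsExcellentRing.of_essFiniteType`); it has dimension `dim Â/P̂₁ = 3` by the dimension formula
for residually algebraic valuations (`ringKrullDim_locAtCentre_closure_eq`); `K̂₁` is algebraic
over it; residues of `O'` are algebraic over it because they are over `Â`; a regular system of
parameters exists (`exists_regularSystemOfParameters`).

What is NOT here: the existence of the model `t₀` (journal Prop. 4.6 / Thm. 1.1 (ii) for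
`Spec Â`, or a local uniformization of `v̂` on `Â/P̂₁` inside `(Â/P̂₁)_{P∞}`), and
`dim Â/P̂₁ = 3` (formal equidimensionality, `FormalEquidimensionality.lean`, for the local rings
`B_𝔭` of algebras of finite type over a field).

## Sources

* V. Cossart, O. Piltant, J. Algebra 529 (2019) 268–535 = arXiv:1412.0868, proof of Prop. 4.8
  with Lemma 4.7 and (510)–(512) (arXiv v1: Prop. 4.6, pp. 52–53). [CossartPiltant2019]
* H. Matsumura, *Commutative Ring Theory* (1986), Thm. 15.6, §32 p. 260. [Matsumura1987]
-/

noncomputable section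

open AlgebraicGeometry CategoryTheory

namespace Literature.AlgebraicGeometry.Resolution

universe u

open IsLocalRing _root_.Polynomial Function

section Model

variable {A : Type u} [CommRing A] [IsDomain A] [IsLocalRing A] [IsNoetherianRing A]
  {K : Type u} [Field K] [Algebra A K] [IsFractionRing A K]

omit [IsDomain A] in
/-- **Residues of `O'` are algebraic over any local `Â`-subalgebra of `K̂₁` dominated by `O'`**
(elementary form): if every `y ∈ O'` is a root modulo `𝔪_{O'}` of a polynomial over `Â` with a
coefficient outside `𝔪_A Â`, then the same holds over a local ring `S` through which `Â → K̂₁`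
factors (a coefficient outside `𝔪_Â` is a unit, hence maps to a unit of `S`). [folklore] -/
private theorem residuallyAlgebraic_of_adicCompletion_algebra
    {K₁ : Type u} [Field K₁] [Algebra (AdicCompletion (maximalIdeal A) A) K₁]
    (O' : ValuationSubring K₁)
    (halgO' : ∀ y : O', ∃ p : Polynomial (AdicCompletion (maximalIdeal A) A),
      (∃ i, p.coeff i ∉ (maximalIdeal A).map (algebraMap A (AdicCompletion (maximalIdeal A) A))) ∧
      O'.valuation (p.eval₂ (algebraMap (AdicCompletion (maximalIdeal A) A) K₁) y) < 1)
    {S : Type u} [CommRing S] [IsLocalRing S] [Algebra (AdicCompletion (maximalIdeal A) A) S]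
    [Algebra S K₁] [IsScalarTower (AdicCompletion (maximalIdeal A) A) S K₁] :
    ∀ y : O', ∃ q : S[X], (∃ i, q.coeff i ∉ maximalIdeal S) ∧
      O'.valuation (q.eval₂ (algebraMap S K₁) y) < 1 := by
  intro y
  obtain ⟨p, ⟨i, hi⟩, hv⟩ := halgO' y
  refine ⟨p.map (algebraMap (AdicCompletion (maximalIdeal A) A) S), ⟨i, ?_⟩, ?_⟩
  · rw [Polynomial.coeff_map]
    rw [← AdicCompletion.maximalIdeal_eq_map] at hi
    have hu : IsUnit (p.coeff i) := by
      by_contra hnu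
      exact hi ((IsLocalRing.mem_maximalIdeal _).mpr (mem_nonunits_iff.mpr hnu))
    intro hm
    exact (mem_nonunits_iff.mp ((IsLocalRing.mem_maximalIdeal _).mp hm)) (hu.map _)
  · rw [Polynomial.eval₂_map, ← IsScalarTower.algebraMap_eq]
    exact hv

set_option maxHeartbeats 1600000 in
/-- **(LU) for `A` at `v` from a regular model of `Â/P̂₁` at `v̂` with `K`-finite denominators**
(the geometric head of Cossart–Piltant 2019, Prop. 4.8, everything but the existence of the
model). Data: `A` a Noetherian local domain essentially of finite type over a field `k`,
fraction field `K`, `O` a rank-one valuation ring of `K` containing and dominating `A`, with rank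
data `f₁, …, f_r ∈ 𝔪_A` (`r ≥ 1`, values multiplicatively independent, relations among any `> r`
values); embedded resolution of surfaces `hEmb`; the formal branch `K̂₁` (the kernel `P̂₁` of
`Â → K̂₁` a minimal prime, `K̂₁ = Frac(Â/P̂₁)`, `dim Â/P̂₁ = 3`), `ι : K → K̂₁` compatible with
`A → Â`, and the extension `O'` (`O' ⊇ Â`, residues algebraic over those of `Â`, `O' ∩ K = O`);
and THE MODEL: a finite `t₀ ⊆ K̂₁` such that each `z ∈ t₀` satisfies `a z = x` with `a, x ∈ Â`
and `v̂(a) ≥ v̂(ι b)` for some `b ∈ K^×` (`K`-finite denominators), `Â[t₀] ⊆ O'`, and the local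
ring of `Â[t₀]` at the centre of `v̂` is regular. Conclusion: some finitely generated
`A[t] ⊆ O` is regular at the centre of `O` — (LU) for `A` at `v`. Proof: the local ring
`S₀ = (Â[t₀])_{𝔪_{v̂} ∩ Â[t₀]}` is excellent (essentially of finite type over the complete `Â`),
of dimension `dim Â/P̂₁ = 3` (dimension formula, residually algebraic `v̂`), residually algebraic,
with `K̂₁` algebraic over it and a regular system of parameters; then
`exists_adjoin_isRegularLocalRing_of_frameBase`.
[cite: CossartPiltant2019, proof of Prop. 4.8 with Lemma 4.7 and (510)–(512) (arXiv v1: Prop. 4.6, pp. 52–53)]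
[cite: Matsumura1987, Thm. 15.6 and §32 p. 260] -/
theorem exists_adjoin_isRegularLocalRing_of_model
    (k : Type u) [Field k] [Algebra k A] [Algebra.EssFiniteType k A]
    (hEmb : ∀ (Z : Scheme.{u}) [IsIntegral Z] [IsNoetherian Z], Scheme.IsRegular Z →
      Scheme.IsExcellent Z → ∀ (X : Set Z), IsClosed X → X ≠ Set.univ → topologicalKrullDim X ≤ 2 →
        ∃ (Z' : Scheme.{u}) (π : Z' ⟶ Z), IsProper π ∧ Function.Surjective π.base ∧
          (∃ U : Z.Opens, (U : Set Z) = Xᶜ ∧ IsIso (π ∣_ U)) ∧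
          IsStrictNormalCrossingsDivisor Z' (π.base ⁻¹' X))
    (O : ValuationSubring K) (hrk : Nonempty O.valuation.RankOne)
    (hAO : ∀ x : A, algebraMap A K x ∈ O)
    (hdomA : ∀ x ∈ maximalIdeal A, O.valuation (algebraMap A K x) < 1)
    -- rank data of `v` on `K`
    (r : ℕ) (hr0 : 0 < r) (fA : Fin r → A) (hfAm : ∀ i, fA i ∈ maximalIdeal A)
    (hfA0 : ∀ i, algebraMap A K (fA i) ≠ 0)
    (hind : ∀ p m : Fin r → ℕ, ∏ i, O.valuation (algebraMap A K (fA i)) ^ p i =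
      ∏ i, O.valuation (algebraMap A K (fA i)) ^ m i → p = m)
    (hdepK : ∀ (d : ℕ) (I : Finset (Fin d)) (a : Fin d → K), r < I.card → (∀ k, a k ≠ 0) →
      ∃ c : Fin d → ℤ, (∀ k, k ∉ I → c k = 0) ∧ c ≠ 0 ∧
        ∏ k, O.valuation (a k) ^ (c k).toNat = ∏ k, O.valuation (a k) ^ (-c k).toNat)
    -- the formal branch and the extension
    {K₁ : Type u} [Field K₁] [Algebra (AdicCompletion (maximalIdeal A) A) K₁]
    (hP₁ : RingHom.ker (algebraMap (AdicCompletion (maximalIdeal A) A) K₁) ∈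
      minimalPrimes (AdicCompletion (maximalIdeal A) A))
    (hK₁ : ∀ z : K₁, ∃ a b : AdicCompletion (maximalIdeal A) A,
      z = algebraMap _ K₁ a / algebraMap _ K₁ b)
    (hdimP₁ : ringKrullDim (AdicCompletion (maximalIdeal A) A ⧸
      RingHom.ker (algebraMap (AdicCompletion (maximalIdeal A) A) K₁)) = 3)
    (ι : K →+* K₁) (hι : ι.comp (algebraMap A K) =
      (algebraMap (AdicCompletion (maximalIdeal A) A) K₁).comp
        (algebraMap A (AdicCompletion (maximalIdeal A) A)))
    (O' : ValuationSubring K₁)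
    (hRO' : ∀ x : AdicCompletion (maximalIdeal A) A, algebraMap _ K₁ x ∈ O')
    (halgO' : ∀ y : O', ∃ p : Polynomial (AdicCompletion (maximalIdeal A) A),
      (∃ i, p.coeff i ∉ (maximalIdeal A).map (algebraMap A (AdicCompletion (maximalIdeal A) A))) ∧
      O'.valuation (p.eval₂ (algebraMap (AdicCompletion (maximalIdeal A) A) K₁) y) < 1)
    (hO : O'.comap ι = O)
    -- the model
    (t₀ : Finset K₁)
    (hT₀O : (Algebra.adjoin (AdicCompletion (maximalIdeal A) A) (t₀ : Set K₁)).toSubring ≤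
      O'.toSubring)
    (hreg : IsRegularLocalRing (locAtCentre
      (Algebra.adjoin (AdicCompletion (maximalIdeal A) A) (t₀ : Set K₁)).toSubring O'))
    (hden₀ : ∀ z ∈ (t₀ : Set K₁), ∃ a x : AdicCompletion (maximalIdeal A) A,
      (∃ b : K, b ≠ 0 ∧ O'.valuation (ι b) ≤ O'.valuation (algebraMap _ K₁ a)) ∧
        algebraMap _ K₁ a * z = algebraMap _ K₁ x) :
    ∃ (t : Finset K) (h : (Algebra.adjoin A (t : Set K)).toSubring ≤ O.toSubring),
      IsRegularLocalRing (Localization.AtPrime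
        (Ideal.comap (Subring.inclusion h) (maximalIdeal O))) := by
  classical
  -- notation
  set Ah := AdicCompletion (maximalIdeal A) A with hAhdef
  haveI : IsNoetherianRing Ah := isNoetherianRing_adicCompletion_maximalIdeal A
  set T : Subalgebra Ah K₁ := Algebra.adjoin Ah (t₀ : Set K₁) with hTdef
  set R : Subring K₁ := locAtCentre T.toSubring O' with hRdef
  haveI hRreg : IsRegularLocalRing R := hreg
  have hRO : R ≤ O'.toSubring := locAtCentre_le hT₀O
  have hpos : ∀ b : K, b ≠ 0 → 0 < O'.valuation (ι b) := fun b hb =>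
    zero_lt_iff.mpr ((Valuation.ne_zero_iff _).mpr ((map_ne_zero ι).mpr hb))
  -- `R` as an `Â`-algebra inside `K̂₁`
  have hAhT : ∀ a : Ah, algebraMap Ah K₁ a ∈ T := fun a => T.algebraMap_mem a
  have hAhR : ∀ a : Ah, algebraMap Ah K₁ a ∈ R := fun a => le_locAtCentre _ _ (hAhT a)
  letI algAhR : Algebra Ah R := ((algebraMap Ah K₁).codRestrict R hAhR).toAlgebra
  have hAhRval : ∀ a : Ah, ((algebraMap Ah R a : R) : K₁) = algebraMap Ah K₁ a := fun _ => rfl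
  haveI : IsScalarTower Ah R K₁ := IsScalarTower.of_algebraMap_eq fun a => (hAhRval a).symm
  have hRval : ∀ s : R, algebraMap R K₁ s = (s : K₁) := fun _ => rfl
  -- `R` is essentially of finite type over `Â` (a localization of `Â[t₀]`)
  haveI hEss : Algebra.EssFiniteType Ah R := by
    rw [Algebra.essFiniteType_iff]
    let σ : Finset R := Finset.univ.image fun z : t₀ =>
      (⟨(z : K₁), le_locAtCentre _ _ (Algebra.subset_adjoin z.2)⟩ : R)
    have hσ : (IsScalarTower.toAlgHom Ah R K₁) '' (σ : Set R) = (t₀ : Set K₁) := by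
      ext z
      simp only [σ, Finset.coe_image, Finset.coe_univ, Set.image_univ, Set.mem_image,
        Set.mem_range, IsScalarTower.coe_toAlgHom', Finset.mem_coe]
      constructor
      · rintro ⟨y, ⟨w, rfl⟩, rfl⟩; exact w.2
      · intro hz; exact ⟨⟨z, _⟩, ⟨⟨z, hz⟩, rfl⟩, rfl⟩
    have hmap : (Algebra.adjoin Ah (σ : Set R)).map (IsScalarTower.toAlgHom Ah R K₁) = T := by
      rw [← Algebra.adjoin_image, hσ]
    have hlift : ∀ P : K₁, P ∈ T → ∃ P' : R, P' ∈ Algebra.adjoin Ah (σ : Set R) ∧ (P' : K₁) = P := by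
      intro P hP
      rw [← hmap] at hP
      obtain ⟨P', hP', hPP'⟩ := Subalgebra.mem_map.mp hP
      exact ⟨P', hP', hPP'⟩
    refine ⟨σ, fun s => ?_⟩
    obtain ⟨P, hP, Q, hQ, hvQ, hs⟩ := s.2
    obtain ⟨P', hP', hPP'⟩ := hlift P hP
    obtain ⟨Q', hQ', hQQ'⟩ := hlift Q hQ
    have hQ0 : Q ≠ 0 := ne_zero_of_valuation_eq_one hvQ
    have hQ'unit : IsUnit Q' := by
      by_contra hnu
      have := (not_isUnit_locAtCentre_iff hT₀O Q').mp hnu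
      rw [hQQ', hvQ] at this
      exact lt_irrefl _ this
    refine ⟨Q', hQ', hQ'unit, ?_⟩
    have hsQ : s * Q' = P' := Subtype.ext (by
      change (s : K₁) * (Q' : K₁) = (P' : K₁)
      rw [hQQ', hPP', hs, div_mul_cancel₀ _ hQ0])
    rw [hsQ]; exact hP'
  -- `K̂₁` is algebraic over `R`
  haveI hAlg : Algebra.IsAlgebraic R K₁ := by
    refine ⟨fun z => ?_⟩
    obtain ⟨a, b, hz⟩ := hK₁ z
    by_cases hb : algebraMap Ah K₁ b = 0
    · rw [hz, hb, div_zero]; exact isAlgebraic_zero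
    refine ⟨Polynomial.C (algebraMap Ah R b) * Polynomial.X - Polynomial.C (algebraMap Ah R a), ?_, ?_⟩
    · intro h0
      have := congrArg (fun q : R[X] => q.coeff 1) h0
      simp only [Polynomial.coeff_sub, Polynomial.coeff_C_mul, Polynomial.coeff_X_one, mul_one,
        Polynomial.coeff_C, one_ne_zero, if_false, sub_zero, Polynomial.coeff_zero] at this
      apply hb
      rw [← hAhRval, this]; rfl
    · simp only [map_sub, map_mul, Polynomial.aeval_C, Polynomial.aeval_X, hRval, hAhRval]
      rw [hz, mul_div_cancel₀ _ hb, sub_self]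
  -- excellence
  have hRexc : IsExcellentRing R := (isExcellentRing_of_isAdicComplete Ah).of_essFiniteType hEss
  -- injectivity, domination
  have hinj : Function.Injective (algebraMap R K₁) := fun a b h => Subtype.ext h
  have hS₀O : ∀ s : R, algebraMap R K₁ s ∈ O' := fun s => hRO s.2
  have hdomS₀ : ∀ s ∈ maximalIdeal R, O'.valuation (algebraMap R K₁ s) < 1 := fun s hs =>
    (mem_maximalIdeal_locAtCentre_iff hT₀O s).mp hs
  have hres : ∀ y : O', ∃ q : R[X], (∃ i, q.coeff i ∉ maximalIdeal R) ∧
      O'.valuation (q.eval₂ (algebraMap R K₁) y) < 1 :=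
    residuallyAlgebraic_of_adicCompletion_algebra O' halgO'
  -- the base ring `Ā = Â/P̂₁ ⊆ K̂₁` and the dimension of `R`
  set Abar : Subring K₁ := (algebraMap Ah K₁).range with hAbardef
  let πbar : Ah →+* Abar := (algebraMap Ah K₁).rangeRestrict
  have hπbar : Function.Surjective πbar := (algebraMap Ah K₁).rangeRestrict_surjective
  haveI : Nontrivial Abar := ⟨⟨0, 1, fun h => zero_ne_one (congrArg Subtype.val h)⟩⟩
  haveI : IsLocalRing Abar := IsLocalRing.of_surjective' πbar hπbar
  have hkerπ : RingHom.ker πbar = RingHom.ker (algebraMap Ah K₁) := by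
    ext a
    simp only [RingHom.mem_ker]
    constructor
    · intro h; exact congrArg Subtype.val h
    · intro h; exact Subtype.ext h
  let ebar : (Ah ⧸ RingHom.ker (algebraMap Ah K₁)) ≃+* Abar :=
    (Ideal.quotEquivOfEq hkerπ.symm).trans (RingHom.quotientKerEquivOfSurjective hπbar)
  have hAbarUC : IsUniversallyCatenaryRing Abar :=
    ((isExcellentRing_of_isAdicComplete Ah).of_surjective πbar hπbar).isUniversallyCatenaryRing
  have hAbarO : Abar ≤ O'.toSubring := by
    rintro _ ⟨a, rfl⟩; exact hRO' a
  have hvalmax : ∀ a ∈ maximalIdeal Ah, O'.valuation (algebraMap Ah K₁ a) < 1 := by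
    intro a ha
    -- the set of elements of `Â` of value `< 1` is an ideal containing `𝔪_A Â = 𝔪_Â`
    have hιA : ∀ x : A, algebraMap Ah K₁ (algebraMap A Ah x) = ι (algebraMap A K x) := fun x => by
      have := RingHom.congr_fun hι x
      simpa only [RingHom.comp_apply] using this.symm
    have hequiv : O.valuation.IsEquiv (O'.valuation.comap ι) := by
      rw [Valuation.isEquiv_iff_valuationSubring, ValuationSubring.valuationSubring_valuation]
      ext z
      rw [Valuation.mem_valuationSubring_iff, Valuation.comap_apply,
        ValuationSubring.valuation_le_one_iff, ← ValuationSubring.mem_comap, hO]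
    let J : Ideal Ah := (maximalIdeal O').comap ((algebraMap Ah K₁).codRestrict O'.toSubring hRO')
    have hJ : ∀ x : Ah, x ∈ J ↔ O'.valuation (algebraMap Ah K₁ x) < 1 := fun x => by
      change (⟨algebraMap Ah K₁ x, hRO' x⟩ : O') ∈ maximalIdeal O' ↔ _
      rw [ValuationSubring.valuation_lt_one_iff]
    have hle : maximalIdeal Ah ≤ J := by
      rw [AdicCompletion.maximalIdeal_eq_map, Ideal.map_le_iff_le_comap]
      intro x hx
      rw [Ideal.mem_comap, hJ, hιA]
      have h1 : O.valuation (algebraMap A K x) < O.valuation 1 := by rw [map_one]; exact hdomA x hx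
      have h2 := (hequiv.lt_iff_lt).mp h1
      simpa only [Valuation.comap_apply, map_one] using h2
    exact (hJ a).mp (hle ha)
  have hAbardom : ∀ r : Abar, r ∈ maximalIdeal Abar → O'.valuation (r : K₁) < 1 := by
    intro r hr
    obtain ⟨a, rfl⟩ := hπbar r
    have ha : a ∈ maximalIdeal Ah := by
      by_contra hna
      have hu : IsUnit a := by
        by_contra hnu; exact hna ((IsLocalRing.mem_maximalIdeal _).mpr (mem_nonunits_iff.mpr hnu))
      exact (mem_nonunits_iff.mp ((IsLocalRing.mem_maximalIdeal _).mp hr)) (hu.map πbar)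
    exact hvalmax a ha
  have hAbaralg : ∀ y : O', ∃ q : Abar[X], (∃ i, q.coeff i ∉ maximalIdeal Abar) ∧
      O'.valuation (aeval (y : K₁) q) < 1 := by
    intro y
    obtain ⟨p, ⟨i, hi⟩, hv⟩ := halgO' y
    refine ⟨p.map πbar, ⟨i, ?_⟩, ?_⟩
    · rw [Polynomial.coeff_map]
      rw [← AdicCompletion.maximalIdeal_eq_map] at hi
      have hu : IsUnit (p.coeff i) := by
        by_contra hnu
        exact hi ((IsLocalRing.mem_maximalIdeal _).mpr (mem_nonunits_iff.mpr hnu))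
      intro hm
      exact (mem_nonunits_iff.mp ((IsLocalRing.mem_maximalIdeal _).mp hm)) (hu.map _)
    · rw [Polynomial.aeval_def, Polynomial.eval₂_map]
      exact hv
  have hb : ∀ y ∈ t₀, ∃ a d : Abar, (d : K₁) ≠ 0 ∧ y = a / d := by
    intro y _
    obtain ⟨a, b, hy⟩ := hK₁ y
    by_cases hb0 : algebraMap Ah K₁ b = 0
    · refine ⟨0, 1, ?_, ?_⟩
      · exact one_ne_zero
      · rw [hy, hb0, div_zero]; simp
    · exact ⟨⟨_, a, rfl⟩, ⟨_, b, rfl⟩, hb0, hy⟩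
  have hclos : Subring.closure ((Abar : Set K₁) ∪ ↑t₀) = T.toSubring := by
    rw [hTdef, Algebra.adjoin_eq_ring_closure]
    rfl
  have hBO : Subring.closure ((Abar : Set K₁) ∪ ↑t₀) ≤ O'.toSubring := by
    rw [hclos]; exact hT₀O
  have hdimR' : ringKrullDim R = ringKrullDim Abar := by
    have h1 := ringKrullDim_locAtCentre_closure_eq O' hAbarUC hAbarO hAbardom hAbaralg t₀ hb hBO
    have h2 : locAtCentre (Subring.closure ((Abar : Set K₁) ∪ ↑t₀)) O' = R := by
      rw [hRdef, hclos]
    rw [h2] at h1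
    exact h1
  have hS₀dim : ringKrullDim R = 3 := by
    rw [hdimR', ← ringKrullDim_eq_of_ringEquiv ebar, hdimP₁]
  -- a regular system of parameters
  obtain ⟨s₀, hs₀⟩ := exists_regularSystemOfParameters (R := R)
  have hfin3 : (maximalIdeal R).spanFinrank = 3 := by
    have h1 := IsRegularLocalRing.spanFinrank_maximalIdeal (R := R)
    rw [hS₀dim] at h1
    exact_mod_cast h1
  let s : Fin 3 → R := fun i => s₀ (Fin.cast hfin3.symm i)
  have hs : Ideal.span (Set.range s) = maximalIdeal R := by
    have : Set.range s = Set.range s₀ := by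
      ext y
      constructor
      · rintro ⟨i, rfl⟩; exact ⟨_, rfl⟩
      · rintro ⟨i, rfl⟩; exact ⟨Fin.cast hfin3 i, by simp [s]⟩
    rw [this, hs₀]
  -- the image of `R` is `R`
  have hR₀ : (algebraMap R K₁).range = locAtCentre T.toSubring O' := by
    ext y
    constructor
    · rintro ⟨s, rfl⟩; exact s.2
    · intro hy; exact ⟨⟨y, hy⟩, rfl⟩
  exact exists_adjoin_isRegularLocalRing_of_frameBase k hEmb O hrk hAO hdomA r hr0 fA hfAm hfA0 hind
    hdepK hP₁ hK₁ ι hι O' hRO' halgO' hO hRexc hS₀dim hinj hS₀O hdomS₀ hres s hs t₀ hR₀ hden₀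

end Model

end Literature.AlgebraicGeometry.Resolution

end
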